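import Mathlib
import HarnessLib

/-!
# Brascamp–Lieb in one dimension, on a compact interval (raw form)

`Literature/Probability/Distributions/`. The case `n = 1` of Brascamp–Lieb's variance inequality
(J. Funct. Anal. 22 (1976), Theorem 4.1), localised to a compact interval `[α, β]` and written
without normalisation: if `g` is twice differentiable on `[α, β]` with `g'' > 0` continuous there
and `H` is `C¹`, then for the constant `c = H(a)` (`a` = the minimum point of `g` on the interval)

  `∫_α^β (H − c)² e^{−g} ≤ ∫_α^β H'² / g'' · e^{−g}`      (`brascampLieb_interval`).

Since `Var_ν H ≤ E_ν (H − c)²` for the probability measure `ν ∝ e^{−g} 1_{[α,β]}`, this is the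
one-dimensional inequality `Var H ≤ ⟨H'²/g''⟩` on an interval. The proof is the paper's (p. 377):
with `u = H − H(a)` and `φ = u²/g' · e^{−g}` one has, pointwise on `{g' ≠ 0}`,
`φ' ≤ (H'²/g'' − u²) e^{−g}` (the difference is a square), and `φ` vanishes at `a` and has the
sign of `g'` elsewhere; the fundamental theorem of calculus in inequality form
(`intervalIntegral.sub_le_integral_of_hasDeriv_right_of_le`) on `[a, β]` and, by reflection, on
`[α, a]` gives the claim. Working on a compact interval (instead of `ℝ` with a global minimum as
in print) is what the cube-induction proof of the `n`-dimensional theorem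
(`BrascampLieb1976_thm41`, file `BrascampLieb`) consumes; no tails or integrability hypotheses
arise. No definitions.

References: H. J. Brascamp, E. H. Lieb, J. Funct. Anal. 22 (1976) 366–389, Thm 4.1.
-/

noncomputable section

open MeasureTheory Set Filter
open scoped Topology

namespace Literature.Probability.Distributions


/-- Right half of the one-dimensional Brascamp–Lieb inequality on `[a, β]` when `g' a ≥ 0`:
`∫_a^β (H − H a)² e^{-g} ≤ ∫_a^β H'²/g'' e^{-g}`. [cite: BrascampLieb1976, Thm 4.1 (n = 1)] -/
theorem brascampLieb_interval_right {a β : ℝ} (hab : a ≤ β) {g g₁ g₂ H H₁ : ℝ → ℝ}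
    (hg : ∀ x ∈ Icc a β, HasDerivAt g (g₁ x) x) (hg₁ : ∀ x ∈ Icc a β, HasDerivAt g₁ (g₂ x) x)
    (hH : ∀ x ∈ Icc a β, HasDerivAt H (H₁ x) x)
    (hg₂c : ContinuousOn g₂ (Icc a β)) (hH₁c : ContinuousOn H₁ (Icc a β))
    (hpos : ∀ x ∈ Icc a β, 0 < g₂ x) (hga : 0 ≤ g₁ a) :
    ∫ x in a..β, (H x - H a) ^ 2 * Real.exp (-g x) ≤
      ∫ x in a..β, (H₁ x) ^ 2 / g₂ x * Real.exp (-g x) := by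
  -- continuity facts
  have hgc : ContinuousOn g (Icc a β) := fun x hx => (hg x hx).continuousAt.continuousWithinAt
  have hg₁c : ContinuousOn g₁ (Icc a β) := fun x hx => (hg₁ x hx).continuousAt.continuousWithinAt
  have hHc : ContinuousOn H (Icc a β) := fun x hx => (hH x hx).continuousAt.continuousWithinAt
  -- a positive lower bound `c` for `g₂` on the interval
  obtain ⟨x₀, hx₀, hmin⟩ := (isCompact_Icc (a := a) (b := β)).exists_isMinOn
    (nonempty_Icc.2 hab) hg₂c
  set c := g₂ x₀ with hc
  have hcpos : 0 < c := hpos x₀ hx₀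
  have hcle : ∀ x ∈ Icc a β, c ≤ g₂ x := fun x hx => hmin hx
  -- lower bound `g₁ x ≥ c (x - a)` on the interval (mean value theorem)
  have hg₁lb : ∀ x ∈ Icc a β, c * (x - a) ≤ g₁ x := by
    intro x hx
    have hmvt := (convex_Icc a β).mul_sub_le_image_sub_of_le_deriv hg₁c
      (fun y hy => by
        rw [interior_Icc] at hy
        exact ((hg₁ y (Ioo_subset_Icc_self hy)).differentiableAt).differentiableWithinAt)
      (C := c) (fun y hy => by
        rw [interior_Icc] at hy
        rw [(hg₁ y (Ioo_subset_Icc_self hy)).deriv]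
        exact hcle y (Ioo_subset_Icc_self hy))
      a (left_mem_Icc.2 hab) x hx hx.1
    linarith
  have hg₁pos : ∀ x ∈ Ioc a β, 0 < g₁ x := by
    intro x hx
    have := hg₁lb x (Ioc_subset_Icc_self hx)
    have : 0 < c * (x - a) := mul_pos hcpos (by linarith [hx.1])
    linarith
  -- a bound `L` for `|H₁|` and the Lipschitz estimate `|H x - H a| ≤ L (x - a)`
  obtain ⟨L, hL⟩ := (isCompact_Icc (a := a) (b := β)).exists_bound_of_continuousOn hH₁c
  have hLnn : 0 ≤ L := le_trans (norm_nonneg _) (hL a (left_mem_Icc.2 hab))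
  have hLip : ∀ x ∈ Icc a β, |H x - H a| ≤ L * (x - a) := by
    intro x hx
    have := (convex_Icc a β).norm_image_sub_le_of_norm_hasDerivWithin_le
      (fun y hy => (hH y hy).hasDerivWithinAt) hL (left_mem_Icc.2 hab) hx
    rw [Real.norm_eq_abs, Real.norm_eq_abs, abs_of_nonneg (show (0:ℝ) ≤ x - a by linarith [hx.1])]
      at this
    exact this
  -- a bound `E` for `exp (-g)` on the interval
  obtain ⟨E, hE⟩ := (isCompact_Icc (a := a) (b := β)).exists_bound_of_continuousOn
    (hgc.neg.rexp)
  -- the auxiliary function φ and its derivative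
  obtain ⟨u, hu⟩ : ∃ u : ℝ → ℝ, u = fun x => H x - H a := ⟨_, rfl⟩
  obtain ⟨φ, hφ⟩ : ∃ φ : ℝ → ℝ, φ = fun x => (u x) ^ 2 / g₁ x * Real.exp (-g x) := ⟨_, rfl⟩
  obtain ⟨φ', hφ'⟩ : ∃ φ' : ℝ → ℝ, φ' = fun x =>
    (2 * u x * H₁ x / g₁ x - (u x) ^ 2 * g₂ x / (g₁ x) ^ 2 - (u x) ^ 2) * Real.exp (-g x) :=
    ⟨_, rfl⟩
  obtain ⟨ψ, hψ⟩ : ∃ ψ : ℝ → ℝ, ψ = fun x => ((H₁ x) ^ 2 / g₂ x - (u x) ^ 2) * Real.exp (-g x) :=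
    ⟨_, rfl⟩
  have hua : u a = 0 := by simp [hu]
  have hφa : φ a = 0 := by simp [hφ, hua]
  have hu_c : ∀ x ∈ Icc a β, ContinuousWithinAt u (Icc a β) x := fun x hx => by
    rw [hu]; exact (hHc x hx).sub continuousWithinAt_const
  -- φ is continuous on [a, β]
  have hφcont : ContinuousOn φ (Icc a β) := by
    intro x hx
    rcases eq_or_lt_of_le hx.1 with h | h
    · -- at the left endpoint: squeeze
      subst h
      rw [ContinuousWithinAt, hφa]
      have hbound : ∀ y ∈ Icc a β, ‖φ y‖ ≤ L ^ 2 * E / c * (y - a) := by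
        intro y hy
        rcases eq_or_lt_of_le hy.1 with h' | h'
        · subst h'; simp [hφa]
        · have hy' : y ∈ Ioc a β := ⟨h', hy.2⟩
          have huy : u y = H y - H a := by simp [hu]
          have h1 : 0 < g₁ y := hg₁pos y hy'
          have h2 := hg₁lb y hy
          have h3 := hLip y hy
          have h4 : ‖Real.exp (-g y)‖ ≤ E := hE y hy
          rw [Real.norm_eq_abs, abs_of_nonneg (Real.exp_pos _).le] at h4
          have hya : 0 < y - a := by linarith
          rw [Real.norm_eq_abs, hφ]
          simp only
          rw [abs_of_nonneg (by positivity)]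
          have h5 : (u y) ^ 2 ≤ (L * (y - a)) ^ 2 := by
            rw [← sq_abs, huy]; exact pow_le_pow_left₀ (abs_nonneg _) h3 2
          calc (u y) ^ 2 / g₁ y * Real.exp (-g y)
              ≤ (L * (y - a)) ^ 2 / (c * (y - a)) * E := by
                gcongr
            _ = L ^ 2 * E / c * (y - a) := by field_simp
      refine squeeze_zero_norm' (eventually_nhdsWithin_of_forall hbound) ?_
      have : Tendsto (fun y => L ^ 2 * E / c * (y - a)) (𝓝 a) (𝓝 (L ^ 2 * E / c * (a - a))) :=
        ((continuous_const.mul (continuous_id.sub continuous_const)).tendsto a)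
      rw [sub_self, mul_zero] at this
      exact this.mono_left nhdsWithin_le_nhds
    · have hx' : x ∈ Ioc a β := ⟨h, hx.2⟩
      have h1 : g₁ x ≠ 0 := (hg₁pos x hx').ne'
      rw [hφ]
      exact (((hu_c x hx).pow 2).div (hg₁c x hx) h1).mul (hgc x hx).neg.rexp
  -- φ has derivative φ' on (a, β)
  have hφder : ∀ x ∈ Ioo a β, HasDerivAt φ (φ' x) x := by
    intro x hx
    have hxI : x ∈ Icc a β := Ioo_subset_Icc_self hx
    have h1 : g₁ x ≠ 0 := (hg₁pos x ⟨hx.1, hx.2.le⟩).ne'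
    have hu' : HasDerivAt u (H₁ x) x := by
      rw [hu]; exact (hH x hxI).sub_const (H a)
    have hA : HasDerivAt (fun y => (u y) ^ 2 / g₁ y) _ x := (hu'.pow 2).div (hg₁ x hxI) h1
    have hB : HasDerivAt (fun y => Real.exp (-g y)) _ x := (hg x hxI).neg.exp
    rw [hφ]
    refine (hA.mul hB).congr_deriv ?_
    rw [hφ']
    simp only [Pi.pow_apply, Pi.neg_apply]
    field_simp
    ring
  -- ψ is integrable on [a, β]
  have hψc : ContinuousOn ψ (Icc a β) := by
    intro x hx
    rw [hψ]
    exact ((((hH₁c x hx).pow 2).div (hg₂c x hx) (hpos x hx).ne').sub ((hu_c x hx).pow 2)).mul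
      (hgc x hx).neg.rexp
  have hψint : IntegrableOn ψ (Icc a β) := hψc.integrableOn_compact isCompact_Icc
  -- φ' ≤ ψ on (a, β)
  have hle : ∀ x ∈ Ioo a β, φ' x ≤ ψ x := by
    intro x hx
    have hxI : x ∈ Icc a β := Ioo_subset_Icc_self hx
    have h1 : 0 < g₁ x := hg₁pos x ⟨hx.1, hx.2.le⟩
    have h2 : 0 < g₂ x := hpos x hxI
    have key : ψ x - φ' x =
        (H₁ x * g₁ x - u x * g₂ x) ^ 2 / (g₂ x * (g₁ x) ^ 2) * Real.exp (-g x) := by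
      simp only [hψ, hφ']
      field_simp
      ring
    have : 0 ≤ ψ x - φ' x := by rw [key]; positivity
    linarith
  -- FTC inequality
  have hmain := intervalIntegral.sub_le_integral_of_hasDeriv_right_of_le hab hφcont
    (fun x hx => (hφder x hx).hasDerivWithinAt) hψint hle
  have hφβ : 0 ≤ φ β := by
    rw [hφ]
    simp only
    have : 0 ≤ g₁ β := by
      rcases eq_or_lt_of_le hab with h | h
      · subst h; exact hga
      · exact (hg₁pos β ⟨h, le_rfl⟩).le
    positivity
  rw [hφa, sub_zero] at hmain
  have h0 : 0 ≤ ∫ x in a..β, ψ x := le_trans hφβ hmain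
  -- split ψ
  have hI1 : IntervalIntegrable (fun x => (H₁ x) ^ 2 / g₂ x * Real.exp (-g x)) volume a β := by
    apply ContinuousOn.intervalIntegrable
    rw [uIcc_of_le hab]
    intro x hx
    exact (((hH₁c x hx).pow 2).div (hg₂c x hx) (hpos x hx).ne').mul (hgc x hx).neg.rexp
  have hI2 : IntervalIntegrable (fun x => (H x - H a) ^ 2 * Real.exp (-g x)) volume a β := by
    apply ContinuousOn.intervalIntegrable
    rw [uIcc_of_le hab]
    intro x hx
    have := (hu_c x hx).pow 2
    rw [hu] at this
    exact this.mul (hgc x hx).neg.rexp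
  have hsplit : ∫ x in a..β, ψ x = (∫ x in a..β, (H₁ x) ^ 2 / g₂ x * Real.exp (-g x)) -
      ∫ x in a..β, (H x - H a) ^ 2 * Real.exp (-g x) := by
    rw [← intervalIntegral.integral_sub hI1 hI2]
    apply intervalIntegral.integral_congr
    intro x _
    simp only [hψ, hu]
    ring
  rw [hsplit] at h0
  linarith

/-- Left half of the one-dimensional Brascamp–Lieb inequality on `[α, a]` when `g' a ≤ 0`
(the reflection `x ↦ -x` of `brascampLieb_interval_right`). [cite: BrascampLieb1976, Thm 4.1 (n = 1)] -/
theorem brascampLieb_interval_left {α a : ℝ} (hab : α ≤ a) {g g₁ g₂ H H₁ : ℝ → ℝ}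
    (hg : ∀ x ∈ Icc α a, HasDerivAt g (g₁ x) x) (hg₁ : ∀ x ∈ Icc α a, HasDerivAt g₁ (g₂ x) x)
    (hH : ∀ x ∈ Icc α a, HasDerivAt H (H₁ x) x)
    (hg₂c : ContinuousOn g₂ (Icc α a)) (hH₁c : ContinuousOn H₁ (Icc α a))
    (hpos : ∀ x ∈ Icc α a, 0 < g₂ x) (hga : g₁ a ≤ 0) :
    ∫ x in α..a, (H x - H a) ^ 2 * Real.exp (-g x) ≤
      ∫ x in α..a, (H₁ x) ^ 2 / g₂ x * Real.exp (-g x) := by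
  have hmem : ∀ x ∈ Icc (-a) (-α), -x ∈ Icc α a := fun x hx => ⟨by linarith [hx.2], by linarith [hx.1]⟩
  have hmaps : MapsTo (fun x : ℝ => -x) (Icc (-a) (-α)) (Icc α a) := fun x hx => hmem x hx
  have key := brascampLieb_interval_right (a := -a) (β := -α) (neg_le_neg hab)
    (g := fun x => g (-x)) (g₁ := fun x => -g₁ (-x)) (g₂ := fun x => g₂ (-x))
    (H := fun x => H (-x)) (H₁ := fun x => -H₁ (-x))
    (fun x hx => ((hg (-x) (hmem x hx)).comp x (hasDerivAt_neg x)).congr_deriv (by ring))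
    (fun x hx => ((hg₁ (-x) (hmem x hx)).comp x (hasDerivAt_neg x)).neg.congr_deriv (by ring))
    (fun x hx => ((hH (-x) (hmem x hx)).comp x (hasDerivAt_neg x)).congr_deriv (by ring))
    (hg₂c.comp continuousOn_neg hmaps) ((hH₁c.comp continuousOn_neg hmaps).neg)
    (fun x hx => hpos (-x) (hmem x hx)) (by simpa using hga)
  have e1 := intervalIntegral.integral_comp_neg (a := -a) (b := -α)
    (fun y => (H y - H a) ^ 2 * Real.exp (-g y))
  have e2 := intervalIntegral.integral_comp_neg (a := -a) (b := -α)
    (fun y => (H₁ y) ^ 2 / g₂ y * Real.exp (-g y))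
  simp only [neg_neg] at e1 e2 key
  have e3 : ∫ x in -a..-α, (-H₁ (-x)) ^ 2 / g₂ (-x) * Real.exp (-g (-x)) =
      ∫ x in -a..-α, (H₁ (-x)) ^ 2 / g₂ (-x) * Real.exp (-g (-x)) := by
    apply intervalIntegral.integral_congr; intro x _; simp only [neg_sq]
  rw [e3, e1, e2] at key
  exact key

/-- **One-dimensional Brascamp–Lieb inequality on a compact interval (raw form).** If `g` is `C²`
with `g'' > 0` on `[α, β]` and `H` is `C¹` there, then for some constant `c` (namely `H` at the
minimum point of `g`), `∫_α^β (H − c)² e^{-g} ≤ ∫_α^β H'²/g'' e^{-g}`. This is the case `n = 1` of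
Brascamp–Lieb's Theorem 4.1, proved as in the paper (pp. 377) by the identity
`h'²/f'' F − (h − h(a))² F ≥ (k² f′ F)′`, `k = (h − h(a))/f′`, here localised to an interval.
[cite: BrascampLieb1976, Thm 4.1 (n = 1)] -/
theorem brascampLieb_interval {α β : ℝ} (hαβ : α ≤ β) {g g₁ g₂ H H₁ : ℝ → ℝ}
    (hg : ∀ x ∈ Icc α β, HasDerivAt g (g₁ x) x) (hg₁ : ∀ x ∈ Icc α β, HasDerivAt g₁ (g₂ x) x)
    (hH : ∀ x ∈ Icc α β, HasDerivAt H (H₁ x) x)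
    (hg₂c : ContinuousOn g₂ (Icc α β)) (hH₁c : ContinuousOn H₁ (Icc α β))
    (hpos : ∀ x ∈ Icc α β, 0 < g₂ x) :
    ∃ c : ℝ, ∫ x in α..β, (H x - c) ^ 2 * Real.exp (-g x) ≤
      ∫ x in α..β, (H₁ x) ^ 2 / g₂ x * Real.exp (-g x) := by
  have hg₁c : ContinuousOn g₁ (Icc α β) := fun x hx => (hg₁ x hx).continuousAt.continuousWithinAt
  have hgc : ContinuousOn g (Icc α β) := fun x hx => (hg x hx).continuousAt.continuousWithinAt
  have hHc : ContinuousOn H (Icc α β) := fun x hx => (hH x hx).continuousAt.continuousWithinAt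
  -- a point `a` with `g₁ ≤ 0` to its left end and `g₁ ≥ 0` at it (or an endpoint)
  obtain ⟨a, ha, hright, hleft⟩ : ∃ a ∈ Icc α β, (0 ≤ g₁ a ∨ a = β) ∧ (g₁ a ≤ 0 ∨ a = α) := by
    by_cases h1 : 0 ≤ g₁ α
    · exact ⟨α, left_mem_Icc.2 hαβ, Or.inl h1, Or.inr rfl⟩
    by_cases h2 : g₁ β ≤ 0
    · exact ⟨β, right_mem_Icc.2 hαβ, Or.inr rfl, Or.inl h2⟩
    push Not at h1 h2
    obtain ⟨a, ha, ha0⟩ := intermediate_value_Icc hαβ hg₁c ⟨h1.le, h2.le⟩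
    exact ⟨a, ha, Or.inl ha0.ge, Or.inl ha0.le⟩
  refine ⟨H a, ?_⟩
  have hsub1 : Icc a β ⊆ Icc α β := Icc_subset_Icc ha.1 le_rfl
  have hsub2 : Icc α a ⊆ Icc α β := Icc_subset_Icc le_rfl ha.2
  -- right piece
  have hR : ∫ x in a..β, (H x - H a) ^ 2 * Real.exp (-g x) ≤
      ∫ x in a..β, (H₁ x) ^ 2 / g₂ x * Real.exp (-g x) := by
    rcases hright with h | h
    · exact brascampLieb_interval_right ha.2 (fun x hx => hg x (hsub1 hx)) (fun x hx => hg₁ x (hsub1 hx))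
        (fun x hx => hH x (hsub1 hx)) (hg₂c.mono hsub1) (hH₁c.mono hsub1)
        (fun x hx => hpos x (hsub1 hx)) h
    · subst h; simp
  -- left piece
  have hL : ∫ x in α..a, (H x - H a) ^ 2 * Real.exp (-g x) ≤
      ∫ x in α..a, (H₁ x) ^ 2 / g₂ x * Real.exp (-g x) := by
    rcases hleft with h | h
    · exact brascampLieb_interval_left ha.1 (fun x hx => hg x (hsub2 hx)) (fun x hx => hg₁ x (hsub2 hx))
        (fun x hx => hH x (hsub2 hx)) (hg₂c.mono hsub2) (hH₁c.mono hsub2)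
        (fun x hx => hpos x (hsub2 hx)) h
    · subst h; simp
  -- add
  have hc1 : ContinuousOn (fun x => (H x - H a) ^ 2 * Real.exp (-g x)) (Icc α β) :=
    ((hHc.sub continuousOn_const).pow 2).mul hgc.neg.rexp
  have hc2 : ContinuousOn (fun x => (H₁ x) ^ 2 / g₂ x * Real.exp (-g x)) (Icc α β) :=
    ((hH₁c.pow 2).div hg₂c fun x hx => (hpos x hx).ne').mul hgc.neg.rexp
  have i1 : ∀ {s t : ℝ}, α ≤ s → s ≤ t → t ≤ β →
      IntervalIntegrable (fun x => (H x - H a) ^ 2 * Real.exp (-g x)) volume s t :=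
    fun h1 h2 h3 => (hc1.mono (by rw [uIcc_of_le h2]; exact Icc_subset_Icc h1 h3)).intervalIntegrable
  have i2 : ∀ {s t : ℝ}, α ≤ s → s ≤ t → t ≤ β →
      IntervalIntegrable (fun x => (H₁ x) ^ 2 / g₂ x * Real.exp (-g x)) volume s t :=
    fun h1 h2 h3 => (hc2.mono (by rw [uIcc_of_le h2]; exact Icc_subset_Icc h1 h3)).intervalIntegrable
  rw [← intervalIntegral.integral_add_adjacent_intervals (i1 le_rfl ha.1 ha.2) (i1 ha.1 ha.2 le_rfl),
    ← intervalIntegral.integral_add_adjacent_intervals (i2 le_rfl ha.1 ha.2) (i2 ha.1 ha.2 le_rfl)]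
  linarith

/-- `brascampLieb_interval` with set integrals over `Icc α β`.
[cite: BrascampLieb1976, Thm 4.1 (n = 1)] -/
theorem brascampLieb_interval_Icc {α β : ℝ} (hαβ : α ≤ β) {g g₁ g₂ H H₁ : ℝ → ℝ}
    (hg : ∀ x ∈ Icc α β, HasDerivAt g (g₁ x) x) (hg₁ : ∀ x ∈ Icc α β, HasDerivAt g₁ (g₂ x) x)
    (hH : ∀ x ∈ Icc α β, HasDerivAt H (H₁ x) x)
    (hg₂c : ContinuousOn g₂ (Icc α β)) (hH₁c : ContinuousOn H₁ (Icc α β))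
    (hpos : ∀ x ∈ Icc α β, 0 < g₂ x) :
    ∃ c : ℝ, ∫ x in Icc α β, (H x - c) ^ 2 * Real.exp (-g x) ≤
      ∫ x in Icc α β, (H₁ x) ^ 2 / g₂ x * Real.exp (-g x) := by
  obtain ⟨c, hc⟩ := brascampLieb_interval hαβ hg hg₁ hH hg₂c hH₁c hpos
  refine ⟨c, ?_⟩
  rwa [intervalIntegral.integral_of_le hαβ, intervalIntegral.integral_of_le hαβ,
    ← integral_Icc_eq_integral_Ioc, ← integral_Icc_eq_integral_Ioc] at hc

end Literature.Probability.Distributions
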